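import Mathlib
import HarnessLib
import Summits.HubbardSuperconductivity.HubbardSuperconductivity.Theorems.KLProgrammeKLRegimeWickPairKernelDefs
import Summits.HubbardSuperconductivity.HubbardSuperconductivity.Theorems.KLProgrammeKLRegimeWickBubbleColouringsSum
import Summits.HubbardSuperconductivity.HubbardSuperconductivity.Theorems.KLProgrammeKLRegimeWickConservation
import Literature.MathematicalPhysics.QuantumLattice.FejerTopCutoff

/-!
# Route `KLProgramme` — ENGINE child gen 5 (stmt-HubbardSuperconductivity-19918 `KLRegimeEngineV14`), stub `stub_engine_step_values`,
# conjunct (E2-v9): the PARTICLE–PARTICLE channel of the two-line Wick term at the pair labels is `−(K·diag(λ)·K)` on the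
# frequency-resolved pair kernel (E2-WICK-ROADMAP §5 (iii-c) step 2, model half, part 1; cell gate-hubbard-kl, seat p1 g9)

`kernel_dblFold_bubble_self` (p499804) writes the `4`-leg kernel of `dblFold(Δ_×(C₁)Δ_×(C₂)(𝒲⁰𝒲¹))` at labels `Z` as
`−2·4!·(B(Z₂Z₃|Z₀Z₁) + B(Z₀Z₃|Z₁Z₂) − B(Z₀Z₂|Z₁Z₃)) − 120·S₆₂`, `B(A|B) = Σ_{X,Y,X',Y'} contr C₂ X Y · contr C₁ X' Y' · kernel 𝒲 4 (X,X',A) · kernel 𝒲 4 (Y,Y',B)`.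
This file evaluates the particle–particle sum `B(Z₂Z₃|Z₀Z₁)` at the PAIR LABELS `Z = (k′↑+, Q−k′↓+, Q−k↓−, k↑−)` of `klWickPairAmplitude` for
DIAGONAL lines (`contr ℂ Cᵢ = diagContr ℓᵢ`, p499749 — every line of the step is one) and the Wick action `𝒲_n` (conservation laws p495253):

* §1 selection rules of `kernel 𝒲_n 4` / `kernel 𝒲_n 2` at the leg strings that occur (charge, the pair partner `p̄ = (−ω_p, Q − p⃗)` by
  frequency + momentum conservation, the spin assignments), the pair-partner involution, leg transpositions;
* §2 **`bubbleSum_pp_pairLabels`**: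
  `B(Z₂Z₃|Z₀Z₁) = −c₄⁻²·Σ_{x} λ(x)·K_n(Q)((k⃗,ω₀), x)·K_n(Q)(x, (k⃗′,ω₀))`, `c₄ = 4!·(βL²)³` (`vertexFn`'s normalisation), the sum over
  `x = (p⃗, ω) ∈ TorusSite 2 L × MatsubaraIdx M`, `K_n(Q) = klWickPairKernel … n Q` and the PAIR WEIGHT
  `λ(x) = ℓ₂(p)·ℓ₁(p̄) + ℓ₁(p)·ℓ₂(p̄)`, `p = (ω,p⃗)`, `p̄ = (−ω, Q−p⃗)` — i.e. `−c₄⁻²·(K·diagonal λ·K)((k⃗,ω₀),(k⃗′,ω₀))`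
  (`bubbleSum_pp_pairLabels_matrix`), the second-order term of the ladder `T_K = K(1 + diag z′K)⁻¹` of `pairLadderStepAtV8_of_expansion`.
  Both spin assignments `(↑,↓)`, `(↓,↑)` of the internal pair are present and merge (pair-partner involution + antisymmetry), which is why `λ`
  is the SYMMETRISED product of the two line values — for `C₁ = C₂ = E`, `λ = 2·ℓ_E(p)ℓ_E(p̄)`.

Proved; no definitions; model bookkeeping only (no estimates); nothing about the model's physics is asserted beyond exact identities.
-/

noncomputable section

namespace Summit.HubbardSuperconductivity.HubbardSuperconductivity.Theorems.KLRegimeWick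

set_option linter.dupNamespace false -- summit = problem name (single-conjunct summit), D-0017

open Literature.MathematicalPhysics.QuantumLattice GrassmannAlgebra Finset Matrix
open Literature.Probability.LatticeModels
open Summit.HubbardSuperconductivity.HubbardSuperconductivity.Theorems.TwoPointAssembly
open Summit.HubbardSuperconductivity.HubbardSuperconductivity.Theorems.KLProgrammeLegKernels
open Summit.HubbardSuperconductivity.HubbardSuperconductivity.Theorems.KLRegimeSplit

section Model

variable {L M : ℕ} [NeZero L] [NeZero M] (β U μ : ℝ) (K : TrigPolyC4v)

/-! ## §1 Selection rules at the leg strings of the particle–particle colouring, the partner involution, leg swaps -/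

omit [NeZero L] [NeZero M] in
/-- Leg transposition `0 ↔ 1` negates a `4`-leg kernel. -/
theorem kernel_four_swap01 (W : HubbardGrassmann L M) (A B C D : HubbardFieldIdx L M) :
    kernel ℂ W 4 ![B, A, C, D] = -kernel ℂ W 4 ![A, B, C, D] := by
  have h : (![B, A, C, D] : Fin 4 → HubbardFieldIdx L M) = ![A, B, C, D] ∘ Equiv.swap (0 : Fin 4) 1 := by
    funext i; fin_cases i <;> rfl
  rw [h, kernel_comp_perm, Equiv.Perm.sign_swap (by decide)]
  simp

omit [NeZero L] [NeZero M] in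
/-- The leg reordering `(W₀,W₁,W₂,W₃) ↦ (W₃,W₂,W₀,W₁)` (a 4-cycle) negates a `4`-leg kernel. -/
theorem kernel_four_cycle (W : HubbardGrassmann L M) (A B C D : HubbardFieldIdx L M) :
    kernel ℂ W 4 ![D, C, A, B] = -kernel ℂ W 4 ![A, B, C, D] := by
  let σ : Equiv.Perm (Fin 4) := ⟨![3, 2, 0, 1], ![2, 3, 1, 0], by decide, by decide⟩
  have hσ : Equiv.Perm.sign σ = -1 := by decide
  have h : (![D, C, A, B] : Fin 4 → HubbardFieldIdx L M) = ![A, B, C, D] ∘ σ := by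
    funext i; fin_cases i <;> rfl
  rw [h, kernel_comp_perm, hσ]
  simp

omit [NeZero L] [NeZero M] in
/-- The pair partner `p̄ = (−ω_p, Q − p⃗)` is an involution. -/
theorem pairPartner_involutive (Q : TorusSite 2 L) :
    Function.Involutive (fun p : FreqMomentum L M => ((p.1.rev, Q - p.2) : FreqMomentum L M)) := by
  intro p
  simp [Fin.rev_rev]

omit [NeZero L] [NeZero M] in
/-- Frequency conservation of a pair at zero total frequency: `n(p) + n(p′) + 1 = 0 ↔ p′ = −p` on `MatsubaraIdx`. -/
theorem matsubaraInt_add_eq_neg_one_iff (i j : MatsubaraIdx M) : matsubaraInt M i + matsubaraInt M j + 1 = 0 ↔ j = i.rev := by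
  constructor
  · intro h
    apply matsubaraInt_injective M
    rw [matsubaraInt_rev]
    linarith
  · rintro rfl
    rw [matsubaraInt_rev]
    ring

/-- **Charge selection at the `a`-vertex of the particle–particle colouring**: with two incoming legs `ψ̂⁻ψ̂⁻` (`Z₂, Z₃`), a `ψ̂⁻` line end kills
the kernel. -/
theorem kernel_klWickAction_pp_minus_left (n : ℕ) (p : FreqMomentum L M) (σ : Fin 2) (X' : HubbardFieldIdx L M)
    (A B : FreqMomentum L M × Fin 2) :
    kernel ℂ (klWickAction L M β U μ K n) 4 ![((p, σ), 1), X', (A, 1), (B, 1)] = 0 := by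
  rcases X' with ⟨q, c⟩
  refine kernel_klWickAction_eq_zero_of_charge β U μ K n ?_
  fin_cases c <;> simp [Fin.sum_univ_four]

/-- … and so does a `ψ̂⁻` line end in the second slot. -/
theorem kernel_klWickAction_pp_minus_right (n : ℕ) (X : HubbardFieldIdx L M) (p' : FreqMomentum L M) (σ' : Fin 2)
    (A B : FreqMomentum L M × Fin 2) :
    kernel ℂ (klWickAction L M β U μ K n) 4 ![X, ((p', σ'), 1), (A, 1), (B, 1)] = 0 := by
  rcases X with ⟨q, c⟩
  refine kernel_klWickAction_eq_zero_of_charge β U μ K n ?_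
  fin_cases c <;> simp [Fin.sum_univ_four]

/-- **Momentum + frequency selection**: at the incoming pair legs `(Q−k↓−, k↑−)` (frequencies `−ω₀, ω₀`), two outgoing line ends `ψ̂⁺_{pσ}ψ̂⁺_{p′σ′}`
carry the kernel only if `p′ = p̄ = (−ω_p, Q − p⃗)`. -/
theorem kernel_klWickAction_pp_eq_zero_of_ne_partner (n : ℕ) (Q k : TorusSite 2 L) (p p' : FreqMomentum L M) (σ σ' : Fin 2)
    (h : p' ≠ (p.1.rev, Q - p.2)) :
    kernel ℂ (klWickAction L M β U μ K n) 4
      ![((p, σ), 0), ((p', σ'), 0), ((((omega0 M).rev, Q - k), 1), 1), (((omega0 M, k), 0), 1)] = 0 := by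
  by_cases hf : p'.1 = p.1.rev
  · -- the momenta differ in some coordinate
    have hm : p'.2 ≠ Q - p.2 := fun h2 => h (Prod.ext hf h2)
    have : ∃ j : Fin 2, p'.2 j ≠ (Q - p.2) j := by
      by_contra hall
      push Not at hall
      exact hm (funext hall)
    obtain ⟨j, hj⟩ := this
    refine kernel_klWickAction_eq_zero_of_momentum β U μ K n j ?_
    simp only [Fin.sum_univ_four, Matrix.cons_val_zero, Matrix.cons_val_one, Matrix.head_cons, Matrix.cons_val_two, Matrix.tail_cons,
      Matrix.cons_val_three, Fin.isValue, if_true, one_ne_zero, if_false, one_smul, neg_smul, Pi.sub_apply]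
    intro h0
    apply hj
    rw [Pi.sub_apply]
    linear_combination h0
  · refine kernel_klWickAction_eq_zero_of_freq β U μ K n ?_
    simp only [Fin.sum_univ_four, Matrix.cons_val_zero, Matrix.cons_val_one, Matrix.head_cons, Matrix.cons_val_two, Matrix.tail_cons,
      Matrix.cons_val_three, Fin.isValue, if_true, one_ne_zero, if_false, one_mul, neg_mul, matsubaraInt_rev, matsubaraInt_omega0]
    intro h0
    apply hf
    apply (matsubaraInt_add_eq_neg_one_iff p.1 p'.1).1
    linarith

/-- **Spin selection**: with the incoming pair `(↓, ↑)` the outgoing line ends carry opposite spins. -/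
theorem kernel_klWickAction_pp_eq_zero_of_spin_eq (n : ℕ) (Q k : TorusSite 2 L) (p p' : FreqMomentum L M) (σ : Fin 2) :
    kernel ℂ (klWickAction L M β U μ K n) 4
      ![((p, σ), 0), ((p', σ), 0), ((((omega0 M).rev, Q - k), 1), 1), (((omega0 M, k), 0), 1)] = 0 := by
  refine kernel_klWickAction_eq_zero_of_spin β U μ K n ?_
  fin_cases σ <;> simp [Fin.sum_univ_four]


/-! ## §2 The particle–particle channel at the pair labels: `−c₄⁻²·(K·diag λ·K)` -/

omit [NeZero M] in
/-- The normalisation constant `c₄ = 4!·(βL²)³` of `vertexFn … 4` is non-zero for `β ≠ 0`. -/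
theorem vertexFn_four_const_ne_zero (hβ : β ≠ 0) : (((Nat.factorial 4 : ℝ) * (β * (L : ℝ) ^ 2) ^ 3 : ℝ) : ℂ) ≠ 0 := by
  have hL : (L : ℝ) ≠ 0 := Nat.cast_ne_zero.2 (NeZero.ne L)
  exact_mod_cast mul_ne_zero (by positivity) (pow_ne_zero 3 (mul_ne_zero hβ (pow_ne_zero 2 hL)))

omit [NeZero M] in
/-- `kernel 𝒲 4 X = c₄⁻¹ · 𝒱₄(𝒲)(X)`. -/
theorem kernel_four_eq_inv_mul_vertexFn (hβ : β ≠ 0) (G : HubbardGrassmann L M) (X : Fin 4 → HubbardFieldIdx L M) :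
    kernel ℂ G 4 X = (((Nat.factorial 4 : ℝ) * (β * (L : ℝ) ^ 2) ^ 3 : ℝ) : ℂ)⁻¹ * vertexFn L M β G 4 X := by
  rw [vertexFn_def, show (4 - 1 : ℕ) = 3 from rfl, ← mul_assoc, inv_mul_cancel₀ (vertexFn_four_const_ne_zero (L := L) β hβ), one_mul]

/-- **`bubbleSum_pp_pairLabels`** — the particle–particle channel sum of `kernel_dblFold_bubble_self` at the pair labels, for diagonal lines
`C₁, C₂` with values `ℓ₁, ℓ₂`:
`Σ_{X,Y,X',Y'} contr C₂ X Y · contr C₁ X' Y' · kernel 𝒲_n 4 (X, X', Q−k↓−, k↑−) · kernel 𝒲_n 4 (Y, Y', k′↑+, Q−k′↓+)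
   = −c₄⁻²·Σ_{x=(p⃗,ω)} λ(x)·K_n(Q)((k⃗,ω₀),x)·K_n(Q)(x,(k⃗′,ω₀))`,
`λ(x) = ℓ₂(p)ℓ₁(p̄) + ℓ₁(p)ℓ₂(p̄)`, `p = (ω,p⃗)`, `p̄ = (−ω, Q−p⃗)`, `c₄ = 4!(βL²)³`.  Lines: `contr ℂ Cᵢ = diagContr ℓᵢ`
(`contr_klSliceCov_eq_diagContr` etc.). -/
theorem bubbleSum_pp_pairLabels (hβ : β ≠ 0) {C₁ C₂ : Matrix (HubbardFieldIdx L M) (HubbardFieldIdx L M) ℂ} {ℓ₁ ℓ₂ : FreqMomentum L M → ℂ}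
    (h₁ : contr ℂ C₁ = diagContr L M ℓ₁) (h₂ : contr ℂ C₂ = diagContr L M ℓ₂) (n : ℕ) (Q k k' : TorusSite 2 L) :
    ∑ X, ∑ Y, ∑ X', ∑ Y', contr ℂ C₂ X Y * contr ℂ C₁ X' Y' *
        (kernel ℂ (klWickAction L M β U μ K n) 4 ![X, X', ((((omega0 M).rev, Q - k), 1), 1), (((omega0 M, k), 0), 1)] *
          kernel ℂ (klWickAction L M β U μ K n) 4 ![Y, Y', (((omega0 M, k'), 0), 0), ((((omega0 M).rev, Q - k'), 1), 0)]) =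
      -((((Nat.factorial 4 : ℝ) * (β * (L : ℝ) ^ 2) ^ 3 : ℝ) : ℂ)⁻¹ ^ 2 *
        ∑ x : TorusSite 2 L × MatsubaraIdx M,
          (ℓ₂ (x.2, x.1) * ℓ₁ (x.2.rev, Q - x.1) + ℓ₁ (x.2, x.1) * ℓ₂ (x.2.rev, Q - x.1)) *
            (klWickPairKernel L M β U μ K n Q (k, omega0 M) x * klWickPairKernel L M β U μ K n Q x (k', omega0 M))) := by
  set W := klWickAction L M β U μ K n with hW
  set c : ℂ := (((Nat.factorial 4 : ℝ) * (β * (L : ℝ) ^ 2) ^ 3 : ℝ) : ℂ) with hc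
  set Z₂ : HubbardFieldIdx L M := ((((omega0 M).rev, Q - k), 1), 1) with hZ₂
  set Z₃ : HubbardFieldIdx L M := (((omega0 M, k), 0), 1) with hZ₃
  set Z₀ : HubbardFieldIdx L M := (((omega0 M, k'), 0), 0) with hZ₀
  set Z₁ : HubbardFieldIdx L M := ((((omega0 M).rev, Q - k'), 1), 0) with hZ₁
  -- Step 1: both lines are reciprocal pairs read in both orientations
  rw [h₁, h₂]
  simp_rw [mul_assoc, ← Finset.mul_sum]
  rw [sum_diagContr_mul]
  simp_rw [sum_diagContr_mul]
  -- Step 2: charge conservation at the `a`-vertex (incoming legs `ψ̂⁻ψ̂⁻`): only `ψ̂⁺ψ̂⁺` line ends survive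
  have hv1 : ∀ (p : FreqMomentum L M) (σ : Fin 2) (X' : HubbardFieldIdx L M), kernel ℂ W 4 ![((p, σ), 1), X', Z₂, Z₃] = 0 :=
    fun p σ X' => kernel_klWickAction_pp_minus_left β U μ K n p σ X' _ _
  have hv2 : ∀ (X : HubbardFieldIdx L M) (p' : FreqMomentum L M) (σ' : Fin 2), kernel ℂ W 4 ![X, ((p', σ'), 1), Z₂, Z₃] = 0 :=
    fun X p' σ' => kernel_klWickAction_pp_minus_right β U μ K n X p' σ' _ _
  simp only [hv1, hv2, zero_mul, mul_zero, sub_zero, zero_sub, Finset.sum_neg_distrib, mul_neg]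
  -- Step 3: momentum + frequency conservation: the second line sits at the pair partner `p̄`
  have hstep3 : ∀ (p : FreqMomentum L M) (σ : Fin 2),
      ∑ p' : FreqMomentum L M, ∑ σ' : Fin 2, ℓ₁ p' * (kernel ℂ W 4 ![((p, σ), 0), ((p', σ'), 0), Z₂, Z₃] *
          kernel ℂ W 4 ![((p, σ), 1), ((p', σ'), 1), Z₀, Z₁]) =
        ∑ σ' : Fin 2, ℓ₁ (p.1.rev, Q - p.2) * (kernel ℂ W 4 ![((p, σ), 0), (((p.1.rev, Q - p.2), σ'), 0), Z₂, Z₃] *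
          kernel ℂ W 4 ![((p, σ), 1), (((p.1.rev, Q - p.2), σ'), 1), Z₀, Z₁]) := by
    intro p σ
    refine Finset.sum_eq_single (p.1.rev, Q - p.2) (fun p' _ hp' => ?_) (fun h => absurd (Finset.mem_univ _) h)
    refine Finset.sum_eq_zero fun σ' _ => ?_
    rw [kernel_klWickAction_pp_eq_zero_of_ne_partner β U μ K n Q k p p' σ σ' hp', zero_mul, mul_zero]
  simp only [hstep3]
  -- Step 4: spin conservation: the internal pair carries opposite spins
  have hspin : ∀ (p : FreqMomentum L M) (σ : Fin 2),
      kernel ℂ W 4 ![((p, σ), 0), (((p.1.rev, Q - p.2), σ), 0), Z₂, Z₃] = 0 :=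
    fun p σ => kernel_klWickAction_pp_eq_zero_of_spin_eq β U μ K n Q k p _ σ
  simp only [Fin.sum_univ_two, hspin, zero_mul, mul_zero, zero_add, add_zero, Fin.isValue]
  simp only [Finset.sum_const_zero, zero_sub, neg_neg]
  -- Step 5: the `(↓,↑)` assignment is the `(↑,↓)` one at the partner (involution + antisymmetry)
  rw [Finset.sum_add_distrib]
  have hre : ∑ p : FreqMomentum L M, ℓ₂ p * (ℓ₁ (p.1.rev, Q - p.2) *
        (kernel ℂ W 4 ![((p, 1), 0), (((p.1.rev, Q - p.2), 0), 0), Z₂, Z₃] * kernel ℂ W 4 ![((p, 1), 1), (((p.1.rev, Q - p.2), 0), 1), Z₀, Z₁])) =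
      ∑ p : FreqMomentum L M, ℓ₂ (p.1.rev, Q - p.2) * (ℓ₁ p *
        (kernel ℂ W 4 ![((p, 0), 0), (((p.1.rev, Q - p.2), 1), 0), Z₂, Z₃] * kernel ℂ W 4 ![((p, 0), 1), (((p.1.rev, Q - p.2), 1), 1), Z₀, Z₁])) := by
    refine Fintype.sum_bijective (fun p : FreqMomentum L M => ((p.1.rev, Q - p.2) : FreqMomentum L M)) (pairPartner_involutive Q).bijective
      _ _ (fun p => ?_)
    simp only [Fin.rev_rev, sub_sub_cancel, Prod.mk.eta]
    rw [kernel_four_swap01 W ((p, 1), 0), kernel_four_swap01 W ((p, 1), 1)]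
    ring
  rw [hre, ← Finset.sum_add_distrib]
  -- Step 6: read the two surviving kernels as entries of the frequency-resolved pair kernel
  rw [← Equiv.sum_comp (Equiv.prodComm (MatsubaraIdx M) (TorusSite 2 L)), Finset.mul_sum, ← Finset.sum_neg_distrib]
  refine Finset.sum_congr rfl fun p _ => ?_
  simp only [Equiv.prodComm_apply, Prod.swap, klWickPairKernel_apply, Prod.mk.eta]
  rw [kernel_four_cycle W Z₀ Z₁ (((p.1.rev, Q - p.2), 1), 1) ((p, 0), 1), kernel_four_eq_inv_mul_vertexFn β hβ W,
    kernel_four_eq_inv_mul_vertexFn β hβ W]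
  ring

/-- **Matrix form**: the particle–particle channel sum is `−c₄⁻²·(K·diagonal λ·K)((k⃗,ω₀),(k⃗′,ω₀))` on the carrier `TorusSite 2 L × MatsubaraIdx M`
— the second-order term of the resolvent `K(1 + diag z′·K)⁻¹ = K − K·diag z′·K + …` of `pairLadderStepAtV8_of_expansion` with `z′ ∝ λ`. -/
theorem bubbleSum_pp_pairLabels_matrix (hβ : β ≠ 0) {C₁ C₂ : Matrix (HubbardFieldIdx L M) (HubbardFieldIdx L M) ℂ}
    {ℓ₁ ℓ₂ : FreqMomentum L M → ℂ} (h₁ : contr ℂ C₁ = diagContr L M ℓ₁) (h₂ : contr ℂ C₂ = diagContr L M ℓ₂) (n : ℕ) (Q k k' : TorusSite 2 L) :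
    ∑ X, ∑ Y, ∑ X', ∑ Y', contr ℂ C₂ X Y * contr ℂ C₁ X' Y' *
        (kernel ℂ (klWickAction L M β U μ K n) 4 ![X, X', ((((omega0 M).rev, Q - k), 1), 1), (((omega0 M, k), 0), 1)] *
          kernel ℂ (klWickAction L M β U μ K n) 4 ![Y, Y', (((omega0 M, k'), 0), 0), ((((omega0 M).rev, Q - k'), 1), 0)]) =
      -((((Nat.factorial 4 : ℝ) * (β * (L : ℝ) ^ 2) ^ 3 : ℝ) : ℂ)⁻¹ ^ 2 *
        (klWickPairKernel L M β U μ K n Q *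
            Matrix.diagonal (fun x : TorusSite 2 L × MatsubaraIdx M =>
              ℓ₂ (x.2, x.1) * ℓ₁ (x.2.rev, Q - x.1) + ℓ₁ (x.2, x.1) * ℓ₂ (x.2.rev, Q - x.1)) *
          klWickPairKernel L M β U μ K n Q) (k, omega0 M) (k', omega0 M)) := by
  rw [bubbleSum_pp_pairLabels β U μ K hβ h₁ h₂ n Q k k', Matrix.mul_apply]
  congr 2
  refine Finset.sum_congr rfl fun x _ => ?_
  rw [Matrix.mul_diagonal]
  ring

end Model

end Summit.HubbardSuperconductivity.HubbardSuperconductivity.Theorems.KLRegimeWick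

end
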